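import Summits.QuantumAdvantage.QuantumAdvantage.Theorems.SoloInformedQueryLift
import Literature.Computability.QuantumComplexity.RandomizedQuerySimulation
import HarnessLib

/-!
# Black-box amplitude estimation cannot be canonised: the pseudo-deterministic cost of approximate majority

Solo seat `solo-QuantumAdvantage-informed`, session 3, file 16; companion of file 14
(`SoloInformedQueryLift`: completions, `psdQuantumQueryComplexity`, `D(P on D) ≤ 4096 · psdQ₂⁶`,
Simon's exponential promise/pseudo-determinism gap).

File 14 showed that canonising a quantum answer off the promise can cost the whole quantum
SPEEDUP (Simon). This file isolates the other half: canonising is expensive in the black-box model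
even where NO speedup is at stake, at the very problem the seat's door is about. The door
`Q-EXT ⟺ Q-PSD` (file 5) asks for a pseudo-deterministic estimator of a quantum circuit's acceptance
probability; its black-box version is APPROXIMATE MAJORITY — given query access to the table
`x ∈ {0,1}ᴺ` of accept/reject outcomes, decide whether at least two thirds or at most one third of
the entries are `1` (`gapMajPromise`, `gapMajFn`; the decision form of Goldreich–Goldwasser–Ron's
Hamming-weight estimation `ε-HWE`).

* `gapMaj_randQueryComplexityOn_le_one`, `gapMaj_quantumQueryComplexityOn_le_one`: ONE classical
  query (read a uniformly random position) solves it with error `≤ 1/3`; so `R₂ ≤ 1`, `Q₂ ≤ 1`.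
* `gapMaj_lt_three_mul_detQueryComplexityOn`: every DETERMINISTIC tree correct on the promise has
  depth `> N/3` (adversary: answer `0` to the `≤ N/3` queries, then complete to all-zeros or to
  ones-elsewhere — `DecisionTree.exists_agreeOn_finset`, the generic "a tree sees only the bits on
  its path" lemma).
* `gapMaj_psd_gap`: hence `N < 12288 · psdQ₂(GapMaj_N)⁶` (file 14's `D ≤ 4096 · psdQ₂⁶`): every
  pseudo-deterministic quantum algorithm for approximate majority — equivalently every bounded-error
  quantum algorithm for a LANGUAGE-LIKE (total) version of it — makes `Ω(N^{1/6})` queries, against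
  `1` for the promise problem. Goldreich–Goldwasser–Ron (ITCS 2013) prove the classical `Ω(N)` for
  worst-case pseudo-deterministic Hamming-weight estimation [GIPS2021, p. 36:18, citing GGR13]; the
  quantum sixth-root form is the one relevant to the door.
* `not_psdPolyBounded_rand`: no `C, k` give `psdQ₂(D,P) ≤ C · R₂(P on D)ᵏ + C` — pseudo-deterministic
  QUANTUM query complexity is not even polynomially bounded by RANDOMISED query complexity on the
  promise (file 14 had this against `Q₂` on the promise, via Simon).

**Reading for the summit.** In the oracle world of QA-A08 the promise class separates while the
language classes collapse; files 14 and 16 are its two query-level mechanisms. For the door this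
says: a pseudo-deterministic amplitude estimator (Q-PSD), if it exists, must use the circuit's
DESCRIPTION — sampling its output, however cleverly and even quantumly, cannot be canonised.
Classically the known white-box canonisers are exactly two: fixing the coins by advice (Adleman;
file 15 `SoloInformedNonuniformLift`: the classical doors become theorems non-uniformly) and
pseudorandom generators from hard functions (file 10); neither has a quantum analogue, because
quantum coins are not a tape.

## References
* [GIPS2021] S. Goldwasser, R. Impagliazzo, T. Pitassi, R. Santhanam, *On the pseudo-deterministic
  query complexity of NP search problems*, CCC 2021, LIPIcs 200, 36:1–36:22, p. 36:18 (Thm. 27 and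
  the remark before it: "Goldreich, Goldwasser and Ron [13] showed an Ω(n) query lower bound for
  worst-case bounded-error pseudo-deterministic algorithms solving this problem")
  [corpus: paper:doi-10-4230-lipics-ccc-2021-36 p.18, p.4].
* [GGR2013] O. Goldreich, S. Goldwasser, D. Ron, *On the possibilities and limitations of
  pseudodeterministic algorithms*, ITCS 2013, 127–138.
* [BealsEtAl2001] R. Beals, H. Buhrman, R. Cleve, M. Mosca, R. de Wolf, *Quantum lower bounds by
  polynomials*, J. ACM 48 (2001), Thm 5.4 (tree: `detQueryComplexity_le_4096_mul_pow_six`).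
* [Wolf2002] H. Buhrman, R. de Wolf, *Complexity measures and decision tree complexity: a survey*,
  TCS 288 (2002), §2.1–§3.3 (tree: `DecisionTree`, `quantumQueryComplexityOn_le_randQueryComplexityOn`).
-/

noncomputable section

namespace Summit.QuantumAdvantage.QuantumAdvantage.Theorems

open Finset Literature.Computability.Complexity Literature.Computability.Cryptography
  Literature.Computability.QuantumComplexity Literature.Barriers.QuantumAdvantage

variable {N : ℕ}

/-! ### A decision tree sees only the bits on its path -/

/-- **Adversary lemma.** For every decision tree `T` and input `x` there is a set `S` of at most
`depth T` coordinates (the ones queried along `x`'s path) such that every input agreeing with `x`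
on `S` gets the same answer. [cite: Wolf2002, §2.1] -/
theorem DecisionTree.exists_agreeOn_finset (T : DecisionTree N) (x : Fin N → Bool) :
    ∃ S : Finset (Fin N), S.card ≤ T.depth ∧
      ∀ y : Fin N → Bool, (∀ i ∈ S, y i = x i) → T.eval y = T.eval x := by
  classical
  induction T with
  | leaf b => exact ⟨∅, by simp, fun y _ => rfl⟩
  | query i t₀ t₁ ih₀ ih₁ =>
    obtain ⟨S₀, hS₀, h₀⟩ := ih₀
    obtain ⟨S₁, hS₁, h₁⟩ := ih₁
    cases hxi : x i
    · refine ⟨insert i S₀, ?_, fun y hy => ?_⟩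
      · have h1 := Finset.card_insert_le i S₀
        have h2 := le_max_left t₀.depth t₁.depth
        rw [DecisionTree.depth_query]
        omega
      · have hyi : y i = false := (hy i (Finset.mem_insert_self i S₀)).trans hxi
        simp only [DecisionTree.eval_query, hyi, hxi]
        exact h₀ y fun j hj => hy j (Finset.mem_insert_of_mem hj)
    · refine ⟨insert i S₁, ?_, fun y hy => ?_⟩
      · have h1 := Finset.card_insert_le i S₁
        have h2 := le_max_right t₀.depth t₁.depth
        rw [DecisionTree.depth_query]
        omega
      · have hyi : y i = true := (hy i (Finset.mem_insert_self i S₁)).trans hxi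
        simp only [DecisionTree.eval_query, hyi, hxi]
        exact h₁ y fun j hj => hy j (Finset.mem_insert_of_mem hj)

/-! ### Approximate majority (gap Hamming weight) -/

/-- Hamming weight of a bit table `x ∈ {0,1}ᴺ`: the number of `1` entries. [folklore] -/
def hammingWeight (x : Fin N → Bool) : ℕ :=
  (univ.filter fun i => x i = true).card

/-- `hammingWeight x ≤ N`. [folklore] -/
theorem hammingWeight_le (x : Fin N → Bool) : hammingWeight x ≤ N := by
  unfold hammingWeight
  exact (card_filter_le _ _).trans (by rw [card_univ, Fintype.card_fin])

/-- The number of `0` entries is `N - hammingWeight x`. [folklore] -/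
theorem card_filter_eq_false (x : Fin N → Bool) :
    (univ.filter fun i => x i = false).card = N - hammingWeight x := by
  have h := card_filter_add_card_filter_not (s := (univ : Finset (Fin N)))
    (fun i => x i = true)
  rw [card_univ, Fintype.card_fin] at h
  have h' : (univ.filter fun i => x i = false) = univ.filter fun i => ¬ x i = true := by
    ext i; simp
  rw [h']
  unfold hammingWeight
  omega

/-- The all-zeros table has weight `0`. [folklore] -/
theorem hammingWeight_zero : hammingWeight (fun _ : Fin N => false) = 0 := by
  simp [hammingWeight]

/-- The indicator of the complement of `S` has weight `N - |S|`. [folklore] -/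
theorem hammingWeight_notMem (S : Finset (Fin N)) :
    hammingWeight (fun i => decide (i ∉ S)) = N - S.card := by
  unfold hammingWeight
  have h : (univ.filter fun i => decide (i ∉ S) = true) = univ \ S := by
    ext i; simp
  rw [h, card_univ_sdiff, Fintype.card_fin]

/-- The APPROXIMATE-MAJORITY promise on `N`-bit tables: at most one third or at least two thirds of
the entries are `1` (the decision form of `ε`-Hamming-weight estimation, `ε = 1/6`).
[cite: GIPS2021, p. 36:18] -/
def gapMajPromise (N : ℕ) : Set (Fin N → Bool) :=
  {x | 3 * hammingWeight x ≤ N ∨ 2 * N ≤ 3 * hammingWeight x}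

/-- The approximate-majority function: `1` iff at least two thirds of the entries are `1` (any
total extension would do; this one is the natural threshold). [cite: GIPS2021, p. 36:18] -/
def gapMajFn (N : ℕ) : (Fin N → Bool) → Bool := fun x =>
  decide (2 * N ≤ 3 * hammingWeight x)

/-! ### Upper bound: one random query -/

/-- The one-query trees "output bit `i`". [folklore] -/
def readBit (i : Fin N) : DecisionTree N :=
  DecisionTree.query i (DecisionTree.leaf false) (DecisionTree.leaf true)

/-- `readBit i` outputs `x i`. [folklore] -/
@[simp] theorem eval_readBit (i : Fin N) (x : Fin N → Bool) : (readBit i).eval x = x i := by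
  unfold readBit
  cases h : x i <;> simp [h]

/-- `readBit i` makes one query. [folklore] -/
@[simp] theorem depth_readBit (i : Fin N) : (readBit i).depth = 1 := by
  simp [readBit]

/-- On the promise, at least two thirds of the positions carry the answer bit. [folklore] -/
theorem gapMaj_card_agree {x : Fin N → Bool} (hx : x ∈ gapMajPromise N) :
    2 * N ≤ 3 * (univ.filter fun i => x i = gapMajFn N x).card := by
  have hw := hammingWeight_le x
  by_cases hP : 2 * N ≤ 3 * hammingWeight x
  · have hfn : gapMajFn N x = true := by simp [gapMajFn, hP]
    rw [hfn]
    exact hP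
  · have hfn : gapMajFn N x = false := by simp [gapMajFn, hP]
    rw [hfn, card_filter_eq_false]
    rcases hx with hl | hh
    · omega
    · exact absurd hh hP

/-- **`R₂(GapMaj_N on its promise) ≤ 1`**: query one uniformly random position and output it.
[cite: GIPS2021, p. 36:4 ("a constant-query randomized algorithm")] -/
theorem gapMaj_randQueryComplexityOn_le_one (hN : 1 ≤ N) :
    randQueryComplexityOn (1 / 3) (gapMajPromise N) (gapMajFn N) ≤ 1 := by
  classical
  haveI : Nonempty (Fin N) := ⟨⟨0, hN⟩⟩
  set μ : PMF (DecisionTree N) := (PMF.uniformOfFintype (Fin N)).map readBit with hμ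
  refine Nat.sInf_le ⟨μ, fun T hT => ?_, fun x hx => ?_⟩
  · rw [hμ, PMF.support_map] at hT
    obtain ⟨i, -, rfl⟩ := hT
    simp
  · rw [hμ, PMF.toOuterMeasure_map_apply, PMF.toOuterMeasure_uniformOfFintype_apply,
      Fintype.card_fin]
    have hcard : Fintype.card ↥(readBit ⁻¹' {T : DecisionTree N | T.eval x = gapMajFn N x}) =
        (univ.filter fun i => x i = gapMajFn N x).card :=
      Fintype.card_of_subtype _ fun i => by simp
    rw [hcard]
    have hc := gapMaj_card_agree hx
    set c := (univ.filter fun i => x i = gapMajFn N x).card with hcdef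
    have hNpos : (0 : ℝ) < N := by exact_mod_cast hN
    have hcR : (2 : ℝ) * N ≤ 3 * c := by exact_mod_cast hc
    rw [ENNReal.toReal_div, ENNReal.toReal_natCast, ENNReal.toReal_natCast, le_div_iff₀ hNpos]
    linarith

/-- **`Q₂(GapMaj_N on its promise) ≤ 1`** (a quantum query algorithm simulates the one classical
query; tree theorem `quantumQueryComplexityOn_le_randQueryComplexityOn`). [cite: Wolf2002, §3.3] -/
theorem gapMaj_quantumQueryComplexityOn_le_one (hN : 1 ≤ N) :
    quantumQueryComplexityOn (1 / 3) (gapMajPromise N) (gapMajFn N) ≤ 1 :=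
  (quantumQueryComplexityOn_le_randQueryComplexityOn (by norm_num) _ _).trans
    (gapMaj_randQueryComplexityOn_le_one hN)

/-! ### Lower bound: deterministic trees need depth `> N/3` on the promise -/

/-- **Adversary bound `N < 3 · D(GapMaj_N on its promise)`** (`N ≥ 1`): a tree of depth `d` with
`3d ≤ N` answers the all-zeros table (weight `0`, a NO instance) and the table with ones exactly off
the `≤ d` queried positions (weight `≥ N - d ≥ 2N/3`, a YES instance) identically.
[cite: GIPS2021, p. 36:18 (GGR13's Ω(n))] -/
theorem gapMaj_lt_three_mul_detQueryComplexityOn (hN : 1 ≤ N) :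
    N < 3 * detQueryComplexityOn (gapMajPromise N) (gapMajFn N) := by
  classical
  -- the defining infimum is attained
  have hne : {d | ∃ T : DecisionTree N, T.depth = d ∧
      T.ComputesOn (gapMajPromise N) (gapMajFn N)}.Nonempty := by
    obtain ⟨T, hT, -⟩ := DecisionTree.exists_computes_depth_le (gapMajFn N)
    exact ⟨T.depth, T, rfl, hT.computesOn _⟩
  obtain ⟨T, hTd, hT⟩ := Nat.sInf_mem hne
  change T.depth = detQueryComplexityOn (gapMajPromise N) (gapMajFn N) at hTd
  rw [← hTd]
  by_contra hle
  rw [not_lt] at hle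
  -- the all-zeros input
  set x₀ : Fin N → Bool := fun _ => false with hx₀
  have hx₀D : x₀ ∈ gapMajPromise N := Or.inl (by rw [hx₀, hammingWeight_zero]; omega)
  have hx₀f : gapMajFn N x₀ = false := by
    simp only [gapMajFn, hx₀, hammingWeight_zero, mul_zero, decide_eq_false_iff_not, not_le]
    omega
  obtain ⟨S, hS, hagree⟩ := DecisionTree.exists_agreeOn_finset T x₀
  -- ones off the queried positions
  set y : Fin N → Bool := fun i => decide (i ∉ S) with hy
  have hyw : hammingWeight y = N - S.card := hammingWeight_notMem S
  have hSN : S.card ≤ N := (hS.trans (by omega))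
  have hyD : y ∈ gapMajPromise N := Or.inr (by rw [hyw]; omega)
  have hyf : gapMajFn N y = true := by
    simp only [gapMajFn, hyw, decide_eq_true_eq]
    omega
  have hag : ∀ i ∈ S, y i = x₀ i := fun i hi => by simp [hy, hx₀, hi]
  have h1 : T.eval y = T.eval x₀ := hagree y hag
  rw [hT y hyD, hT x₀ hx₀D, hyf, hx₀f] at h1
  exact Bool.noConfusion h1

/-- **`N < 12288 · psdQ₂(GapMaj_N)⁶`**: every pseudo-deterministic quantum algorithm for approximate
majority — every bounded-error quantum algorithm computing a TOTAL function that agrees with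
approximate majority on its promise — makes more than `(N/12288)^{1/6}` queries
(`N < 3 · D(on promise) ≤ 3 · 4096 · psdQ₂⁶`, file 14). [cite: BealsEtAl2001, Thm 5.4]
[cite: GIPS2021, p. 36:18] -/
theorem gapMaj_lt_psd_pow_six (hN : 1 ≤ N) :
    N < 12288 * psdQuantumQueryComplexity (1 / 3) (gapMajPromise N) (gapMajFn N) ^ 6 := by
  have h1 := gapMaj_lt_three_mul_detQueryComplexityOn hN
  have h2 := detQueryComplexityOn_le_psd_pow_six (gapMajPromise N) (gapMajFn N)
  omega

/-- The same bound for every completion (language-like version) `f` of approximate majority: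
`N < 12288 · Q₂(f)⁶`. [cite: BealsEtAl2001, Thm 5.4] -/
theorem gapMaj_completion_lower_bound (hN : 1 ≤ N) {f : (Fin N → Bool) → Bool}
    (hf : f ∈ completions (gapMajPromise N) (gapMajFn N)) :
    N < 12288 * quantumQueryComplexity (1 / 3) f ^ 6 := by
  have h1 := gapMaj_lt_three_mul_detQueryComplexityOn hN
  have h2 := detQueryComplexityOn_le_of_mem_completions hf
  omega

/-- **The pseudo-determinism gap at approximate majority**: `R₂ ≤ 1` and `Q₂ ≤ 1` on the promise,
but `12288 · psdQ₂⁶ > N`. Black-box amplitude / acceptance-probability estimation, classically a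
one-query task, admits no pseudo-deterministic quantum algorithm with `o(N^{1/6})` queries: the
canonical-value estimator the door Q-PSD asks for must be WHITE-BOX. [cite: GIPS2021, p. 36:18]
[cite: BealsEtAl2001, Thm 5.4] -/
theorem gapMaj_psd_gap (hN : 1 ≤ N) :
    randQueryComplexityOn (1 / 3) (gapMajPromise N) (gapMajFn N) ≤ 1 ∧
      quantumQueryComplexityOn (1 / 3) (gapMajPromise N) (gapMajFn N) ≤ 1 ∧
      N < 12288 * psdQuantumQueryComplexity (1 / 3) (gapMajPromise N) (gapMajFn N) ^ 6 :=
  ⟨gapMaj_randQueryComplexityOn_le_one hN, gapMaj_quantumQueryComplexityOn_le_one hN,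
    gapMaj_lt_psd_pow_six hN⟩

/-- **Pseudo-deterministic quantum query complexity is not polynomially bounded by RANDOMISED query
complexity on the promise**: for no `C, k` is `psdQ₂(D, P) ≤ C · R₂(P on D)ᵏ + C` for all promise
problems (witness: approximate majority, `R₂ ≤ 1` versus `psdQ₂ > (N/12288)^{1/6}`). Compare file 14's
`not_psdPolyBounded` (against `Q₂` on the promise, via Simon). [cite: GIPS2021, p. 36:18]
[cite: BealsEtAl2001, Thm 5.4] -/
theorem not_psdPolyBounded_rand (C k : ℕ) :
    ¬ ∀ (N : ℕ) (D : Set (Fin N → Bool)) (P : (Fin N → Bool) → Bool),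
      psdQuantumQueryComplexity (1 / 3) D P ≤ C * randQueryComplexityOn (1 / 3) D P ^ k + C := by
  intro h
  set N := 12288 * (2 * C) ^ 6 + 1 with hNdef
  have hN : 1 ≤ N := by omega
  have hb := h N (gapMajPromise N) (gapMajFn N)
  have hR := gapMaj_randQueryComplexityOn_le_one hN
  have hlow := gapMaj_lt_psd_pow_six hN
  set p := psdQuantumQueryComplexity (1 / 3) (gapMajPromise N) (gapMajFn N) with hp
  set r := randQueryComplexityOn (1 / 3) (gapMajPromise N) (gapMajFn N) with hr
  have hrk : r ^ k ≤ 1 := by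
    calc r ^ k ≤ 1 ^ k := Nat.pow_le_pow_left hR k
      _ = 1 := one_pow k
  have hp2 : p ≤ 2 * C := by
    have : C * r ^ k ≤ C * 1 := Nat.mul_le_mul_left C hrk
    omega
  have hp6 : p ^ 6 ≤ (2 * C) ^ 6 := Nat.pow_le_pow_left hp2 6
  have : 12288 * p ^ 6 ≤ 12288 * (2 * C) ^ 6 := Nat.mul_le_mul_left _ hp6
  omega

end Summit.QuantumAdvantage.QuantumAdvantage.Theorems

end
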